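import Literature.NumberTheory.EllipticCurves.HeegnerPointsHeckeOrbitOrders
import Literature.NumberTheory.EllipticCurves.HeegnerFormsConductorMul
import Literature.NumberTheory.Congruences.QuadraticCharactersMinusThreeAndFive
import HarnessLib

/-!
# Hu–Shu–Yin's CM points of conductor `9p·n` on `X₀(3⁵)` as level-`243` Heegner forms of the order
# `𝒪_{9pn}` of `ℚ(√−3)`, with Bezout data — the instance of `HeegnerPointsHeckeOrbitOrders*`

Topic `NumberTheory/EllipticCurves/HuShuYin2019`, namespace
`Literature.NumberTheory.EllipticCurves.HuShuYin2019`.  Theorems only: no definition, no named fact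
(D-0026); nothing about any elliptic curve, Selmer group or `L`-value is asserted.

Hu–Shu–Yin, *An explicit Gross–Zagier formula related to the Sylvester conjecture*, Trans. AMS 372
(2019) (arXiv 1708.05266): §1 p. 3 L63–67 "`Y₀(3⁵) = Γ₀(3⁵)\ℋ` … `X₀(3⁵)`", §4.1 p. 10 L92
*"Recall `τ = (2pω − 9)/(9pω − 36) ∈ ℋ` and let `P₁ = [τ, 1]_{U₀(3⁵)}` be the CM point on
`X₀(3⁵)(H_{9p})` and note that `f(P₁) = P₀`"* (`f : X₀(3⁵) → E₉` the modular parametrisation with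
`f([∞]) = O`, p. 10 L59; `p ≡ 4, 7 (mod 9)`, `K = ℚ(√−3)`, `ω = (−1 + √−3)/2`, `H_{9p}` the ring class
field of conductor `9p`).  Clearing denominators, `τ` is the root in `ℋ` of the primitive positive
definite form
  `Q_p = (A, B, C) = (81(p² + 4p + 16), −9(4p² + 17p + 72), 4p² + 18p + 81)`
of discriminant `B² − 4AC = −243p² = (9p)²·d_K` with `243 ∣ A` for `p ≡ 1 (mod 3)` — a level-`243`
Heegner form of the ORDER `𝒪_{9p}` in the sense of the tree's `heegnerForms 243 (−243p²)` (both
`Λ_τ` and `Λ_{243τ}` are proper `𝒪_{9p}`-ideals), although the classical Heegner hypothesis fails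
(`3` ramifies in `K`, `gcd(N, d_K) = 3`).  This file records, for the rows of crux 19804 (VARIANT K of
route `SylvesterTwoHeegnerIndex`) and with NO new definition (the form is written out):

* `sylvesterForm_mem_heegnerForms` — for `p ≡ 1 (mod 3)`, `n ≥ 1` with `gcd(n, C) = 1`:
  `(n²A, nB, C) ∈ heegnerForms 243 ((9pn)²·(−3))` (the CM point `τ/n` of conductor `9pn`, i.e. the
  tower `x(n) = x/n` of `HeegnerFormsConductorMul.lean` over HSY's `P₁`; primitivity from the identity
  `2187 = 9C(19 − 4p) − B(4p − 18)` and `3 ∤ C`);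
* `three_not_dvd_C`, `isCoprime_bezoutC` — `3 ∤ C` and the Bezout datum: with `β = nB`,
  `c = n²·((p² + 4p + 16)/3)·C` one has `4·243·c = β² − (9pn)²d_K` and `gcd(243, c) = 1` for `3 ∤ n`;
* **`levelTransport_self_sylvesterPoint_of_fix`** — for `K` imaginary quadratic with `d_K = −3`,
  `ι : K → ℂ`, `p ≡ 1 (mod 3)`, `n ≥ 1`, `3 ∤ n`, `gcd(n, C) = 1`: every `σ ∈ Aut(ℂ/K[9pn])` fixes the
  point `τ_{(n²A, nB, C)}` of `Y₀(243)` (`LevelTransport 243 σ τ τ`) — the hypothesis `hfix` of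
  `exists_image_kleinJ_eq_kleinJ_heckeNeighbours_of_fix` /
  `exists_ringEquiv_levelTransport_of_isHeckeNeighbour_of_fix` /
  `HeegnerTraceOrders.sum_pointGalHom_eq_lFunction_smul_of_fix` at HSY's tower, from
  `levelTransport_self_of_fix_ringClassField_bezout`;
* `coe_heegnerTau_sylvesterForm` — `τ_{Q_p} = (2pω − 9)/(9pω − 36)` as complex numbers (HSY verbatim).
The trace relation (ES1) along the tower itself is the sibling file `SylvesterCMTowerTraceRelation.lean`.

* `not_dvd_C_of_prime_mod_three_eq_two`, `isCoprime_C_of_forall_prime_mod_three_eq_two` — for a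
  Kolyvagin prime `ℓ ≡ 2 (mod 3)` (inert in `K`, `ℓ ∤ 3pn`) one has `ℓ ∤ C` (as `4C = (4p+9)² + 243` and
  `−3` is not a square mod `ℓ ≡ 5 (mod 6)`, Hardy–Wright Thm. 96 = the tree's
  `SmallQuadraticResidues.not_isSquare_neg_three`), so the hypothesis `IsCoprime (n : ℤ) C` holds for
  every product `n` of such primes and propagates along the whole tower.

## References
* Y. Hu, J. Shu, H. Yin, *An explicit Gross–Zagier formula related to the Sylvester conjecture*,
  Trans. Amer. Math. Soc. 372 (2019) 6905–6925; arXiv 1708.05266 §1 (p. 3 L63–67), §4.1 (p. 10 L59,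
  L92). [HuShuYin2019]
* B. H. Gross, *Heegner points on `X₀(N)`*, 1984, §I.1 (Heegner points of an order `𝒪` with
  `𝒪/𝔫 ≅ ℤ/N`). [Gross1984]
* S. Dasgupta, J. Voight, *Heegner points and Sylvester's conjecture*, in *Arithmetic Geometry*, Clay
  Math. Proc. 8 (2009) 91–102 (the same CM points on `X₀(243)`). [DasguptaVoight2009]

## Mathlib / tree search
Tree: `heegnerForms`, `heegnerTau` (`HeegnerPoints`); `levelTransport_self_of_fix_ringClassField_bezout`
(`HeegnerPointsHeckeOrbitOrders`); `conductorMul_mem_heegnerForms` (`HeegnerFormsConductorMul`);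
`HuShuYin2019.cubeSumCurve` (`HuShuYin2019/SylvesterThreePart`, not imported: no curve is needed here).
`SmallQuadraticResidues.not_isSquare_neg_three` (`Congruences/QuadraticCharactersMinusThreeAndFive`).
Mathlib: `Int.prime_three`, `dvd_prime_pow`, `Prime.coprime_iff_not_dvd`, `IsCoprime.pow_left`,
`IsCoprime.dvd_of_dvd_mul_right`, `IsCoprime.of_isCoprime_of_dvd_right`.
`lean search 'sylvesterForm|sylvesterPoint|2 \* p \* ω - 9'` → nothing before this file.
presearch: [corpus:paper:arxiv-1708.05266 p0010:L92, p0003:L63–67] (the point and the curve);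
galaxy not needed (explicit arithmetic of one printed quadratic irrationality).
-/

noncomputable section

open Complex UpperHalfPlane CongruenceSubgroup PeriodPair NumberField
open scoped MatrixGroups

namespace Literature.NumberTheory.EllipticCurves.HuShuYin2019

open Literature.NumberTheory.EllipticCurves Literature.NumberTheory.EllipticCurves.ModularForms
  Literature.NumberTheory.QuadraticFields.BinaryQuadraticForm
  Literature.NumberTheory.QuadraticFields.Quadratic

/-! ### Arithmetic of the form `Q_p = (81(p²+4p+16), −9(4p²+17p+72), 4p²+18p+81)` -/

/-- `p ≡ 1 (mod 3)` as `p = 3k + 1`. Private helper. [folklore] -/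
private theorem exists_eq_three_mul_add_one {p : ℕ} (hp : p % 3 = 1) : ∃ k : ℕ, p = 3 * k + 1 :=
  ⟨p / 3, by omega⟩

/-- **`3 ∤ C = 4p² + 18p + 81`** for `p ≡ 1 (mod 3)` (`C ≡ 4p² ≡ 1`). [cite: HuShuYin2019, §4.1 (p. 10 L92: the point τ)] -/
theorem three_not_dvd_C {p : ℕ} (hp : p % 3 = 1) :
    ¬ (3 : ℤ) ∣ 4 * (p : ℤ) ^ 2 + 18 * p + 81 := by
  obtain ⟨k, rfl⟩ := exists_eq_three_mul_add_one hp
  rintro ⟨m, hm⟩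
  push_cast at hm
  set q := (k : ℤ) ^ 2 with hq
  have h : 4 * ((3 : ℤ) * k + 1) ^ 2 + 18 * (3 * (k : ℤ) + 1) + 81 = 36 * q + 78 * k + 103 := by
    rw [hq]; ring
  rw [h] at hm
  omega

/-- **`243 ∣ A = 81(p² + 4p + 16)`** for `p ≡ 1 (mod 3)` (`3 ∣ p² + p + 1`): the level-`3⁵` condition
`N ∣ A` of a level-`243` Heegner form — both `Λ_τ` and `Λ_{243τ}` have CM by `𝒪_{9p}`.
[cite: HuShuYin2019, §4.1 (p. 10 L92: P₁ = [τ, 1] ∈ X₀(3⁵)(H_{9p}))] -/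
theorem dvd_A {p : ℕ} (hp : p % 3 = 1) (n : ℤ) :
    (243 : ℤ) ∣ n ^ 2 * (81 * ((p : ℤ) ^ 2 + 4 * p + 16)) := by
  obtain ⟨k, rfl⟩ := exists_eq_three_mul_add_one hp
  exact ⟨n ^ 2 * (3 * (k : ℤ) ^ 2 + 6 * k + 7), by push_cast; ring⟩

/-- **The primitivity identity** `2187·n = 9(nC)·(19 − 4p)·… `: precisely
`9·C·(19 − 4p) − B·(4p − 18) = 2187` for `B = −9(4p² + 17p + 72)`, `C = 4p² + 18p + 81`, whence every
common divisor of `nB` and `C` prime to `n` divides `3⁷`. [cite: HuShuYin2019, §4.1 (p. 10 L92: the point τ)] -/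
theorem bezout_B_C (p : ℤ) :
    9 * (4 * p ^ 2 + 18 * p + 81) * (19 - 4 * p) - (-(9 * (4 * p ^ 2 + 17 * p + 72))) * (4 * p - 18) =
      2187 := by
  ring

/-- **HSY's CM point of conductor `9pn` is a level-`243` Heegner form of the order `𝒪_{9pn}`**: for
`p ≡ 1 (mod 3)`, `n ≥ 1` and `gcd(n, C) = 1`, the form `(n²A, nB, C)` — root `τ/n`, `τ = τ_{Q_p} =
(2pω − 9)/(9pω − 36)` Hu–Shu–Yin's `P₁` — lies in `heegnerForms 243 ((9pn)²·(−3))`: discriminant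
`n²(B² − 4AC) = −243p²n²`, `A > 0`, `243 ∣ n²A`, and primitive (a common divisor `d` of `nB` and `C`
is prime to `n`, so divides `2187 = 3⁷` by `bezout_B_C`, and `3 ∤ C`).  At `n = 1` this is `P₁`
itself; for square-free `n` prime to `3p` it is the CM point of conductor `9pn` above it (the tower of
`HeegnerFormsConductorMul.lean`). [cite: HuShuYin2019, §4.1 (p. 10 L92)] [cite: Gross1984, §I.1] -/
theorem sylvesterForm_mem_heegnerForms {p n : ℕ} (hp : p % 3 = 1) (hn : n ≠ 0)
    (hnC : IsCoprime (n : ℤ) (4 * (p : ℤ) ^ 2 + 18 * p + 81)) :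
    ((n : ℤ) ^ 2 * (81 * ((p : ℤ) ^ 2 + 4 * p + 16)), (n : ℤ) * (-(9 * (4 * (p : ℤ) ^ 2 + 17 * p + 72))),
        4 * (p : ℤ) ^ 2 + 18 * p + 81) ∈
      heegnerForms 243 (((9 * p * n : ℕ) : ℤ) ^ 2 * (-3)) := by
  have hn0 : (0 : ℤ) < n := by exact_mod_cast Nat.pos_of_ne_zero hn
  refine ⟨?_, ?_, dvd_A hp n, ?_⟩
  · simp only
    push_cast
    ring
  · simp only
    have hA : (0 : ℤ) < 81 * ((p : ℤ) ^ 2 + 4 * p + 16) := by positivity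
    exact mul_pos (pow_pos hn0 2) hA
  · intro d hdA hdB hdC
    simp only at hdA hdB hdC
    -- `d` is prime to `n` (it divides `C`, and `gcd(n, C) = 1`)
    have hdn : IsCoprime d (n : ℤ) := (hnC.of_isCoprime_of_dvd_right hdC).symm
    -- `d ∣ 2187 · n`, hence `d ∣ 2187 = 3^7`
    have h2187n : d ∣ 2187 * (n : ℤ) := by
      have h : 2187 * (n : ℤ) = 9 * (4 * (p : ℤ) ^ 2 + 18 * p + 81) * ((19 - 4 * p) * n) -
          (n : ℤ) * (-(9 * (4 * (p : ℤ) ^ 2 + 17 * p + 72))) * (4 * p - 18) := by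
        linear_combination (n : ℤ) * bezout_B_C (p : ℤ)
      rw [h]
      exact dvd_sub (dvd_mul_of_dvd_left (dvd_mul_of_dvd_right hdC _) _) (dvd_mul_of_dvd_left hdB _)
    have h2187 : d ∣ (3 : ℤ) ^ 7 := by
      have h := hdn.dvd_of_dvd_mul_right h2187n
      norm_num at h ⊢
      exact h
    obtain ⟨i, hi, hassoc⟩ := (dvd_prime_pow Int.prime_three 7).mp h2187
    rcases Nat.eq_zero_or_pos i with hi0 | hipos
    · rw [hi0, pow_zero] at hassoc
      exact (associated_one_iff_isUnit).mp hassoc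
    · exfalso
      apply three_not_dvd_C hp
      exact (dvd_pow_self (3 : ℤ) hipos.ne').trans (hassoc.symm.dvd.trans hdC)

/-- **The Bezout datum is prime to the level**: for `p ≡ 1 (mod 3)`, `3 ∤ n` and `gcd(n, C) = 1`… in
fact only `3 ∤ n` is needed: `gcd(243, n²·((p²+4p+16)/3)·C) = 1`, since `(p²+4p+16)/3 ≡ 1`,
`C ≡ 1 (mod 3)`.  Written with `p = 3k + 1`: `(p²+4p+16)/3 = 3k² + 6k + 7`.
[cite: HuShuYin2019, §4.1 (p. 10 L92)] [cite: Gross1984, §I.1 (𝒪/𝔫 ≅ ℤ/N)] -/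
theorem isCoprime_bezoutC {k n : ℕ} (hn3 : ¬ 3 ∣ n) :
    IsCoprime (243 : ℤ)
      ((n : ℤ) ^ 2 * (3 * (k : ℤ) ^ 2 + 6 * k + 7) * (4 * ((3 * k + 1 : ℕ) : ℤ) ^ 2 + 18 * (3 * k + 1 : ℕ) + 81)) := by
  have h3 : (243 : ℤ) = 3 ^ 5 := by norm_num
  rw [h3]
  apply IsCoprime.pow_left
  have hp : (3 * k + 1) % 3 = 1 := by omega
  refine (IsCoprime.mul_right (IsCoprime.mul_right ?_ ?_) ?_)
  · apply IsCoprime.pow_right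
    rw [Prime.coprime_iff_not_dvd Int.prime_three]
    exact_mod_cast hn3
  · rw [Prime.coprime_iff_not_dvd Int.prime_three]
    rintro ⟨m, hm⟩
    set q := (k : ℤ) ^ 2 with hq
    omega
  · rw [Prime.coprime_iff_not_dvd Int.prime_three]
    exact three_not_dvd_C hp

/-- **A Kolyvagin prime does not divide `C`**: for a prime `ℓ ≡ 2 (mod 3)` (the inert primes of
`K = ℚ(√−3)` away from `3`; HSY/ROAD (k): `ℓ ≡ 2 (3)`, `ℓ ∤ 3p`), `ℓ ∤ C = 4p² + 18p + 81` — since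
`4C = (4p + 9)² + 243` and `−3` is not a square modulo a prime `ℓ ≡ 5 (mod 6)` (Hardy–Wright Thm. 96,
the tree's `SmallQuadraticResidues.not_isSquare_neg_three`; for `ℓ = 2`, `C` is odd).  Hence the
hypothesis `IsCoprime (n : ℤ) C` of `sylvesterForm_mem_heegnerForms` holds for every product `n` of such
primes, and `ℓ ∤ C` (`conductorMul_mem_heegnerForms`, `sum_pointGalHom_eq_lFunction_smul_bezout`) along
the whole Kolyvagin tower over `P₁`. [cite: HuShuYin2019, §4.1 (p. 10 L92)] [cite: HardyWright2008, Thm 96] -/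
theorem not_dvd_C_of_prime_mod_three_eq_two {p ℓ : ℕ} (hℓ : ℓ.Prime) (hℓ3 : ℓ % 3 = 2) :
    ¬ (ℓ : ℤ) ∣ 4 * (p : ℤ) ^ 2 + 18 * p + 81 := by
  rintro ⟨m, hm⟩
  rcases hℓ.eq_two_or_odd' with rfl | hodd
  · set q := (p : ℤ) ^ 2 with hq
    push_cast at hm
    omega
  · haveI : Fact ℓ.Prime := ⟨hℓ⟩
    have hodd' : ℓ % 2 = 1 := Nat.odd_iff.mp hodd
    have h6 : ℓ % 6 = 5 := by omega
    apply Literature.NumberTheory.Congruences.SmallQuadraticResidues.not_isSquare_neg_three (p := ℓ) h6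
    -- in `ZMod ℓ`: `C = 0`, so `(4p + 9)² = −243 = −3·9·9`
    have hC : 4 * (p : ZMod ℓ) ^ 2 + 18 * p + 81 = 0 := by
      have h := congrArg (Int.cast : ℤ → ZMod ℓ) hm
      push_cast at h
      rw [ZMod.natCast_self, zero_mul] at h
      exact h
    have hsq : (4 * (p : ZMod ℓ) + 9) ^ 2 = -3 * 9 * 9 := by linear_combination (4 : ZMod ℓ) * hC
    have h3 : (3 : ZMod ℓ) ≠ 0 := by
      intro h
      have h' : ((3 : ℕ) : ZMod ℓ) = 0 := by exact_mod_cast h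
      rw [ZMod.natCast_eq_zero_iff] at h'
      have : ℓ ≤ 3 := Nat.le_of_dvd (by norm_num) h'
      interval_cases ℓ <;> omega
    have h9 : (9 : ZMod ℓ) ≠ 0 := by
      have : (9 : ZMod ℓ) = 3 * 3 := by norm_num
      rw [this]; exact mul_ne_zero h3 h3
    refine ⟨(4 * (p : ZMod ℓ) + 9) * (9 : ZMod ℓ)⁻¹, ?_⟩
    calc (-3 : ZMod ℓ) = -3 * (9 * 9⁻¹) * (9 * 9⁻¹) := by rw [mul_inv_cancel₀ h9]; ring
      _ = (4 * (p : ZMod ℓ) + 9) ^ 2 * 9⁻¹ * 9⁻¹ := by rw [hsq]; ring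
      _ = (4 * (p : ZMod ℓ) + 9) * (9 : ZMod ℓ)⁻¹ * ((4 * (p : ZMod ℓ) + 9) * (9 : ZMod ℓ)⁻¹) := by ring


/-- Consequently `gcd(n, C) = 1` for every `n ≥ 1` all of whose prime factors are `≡ 2 (mod 3)` — the
square-free products of Kolyvagin primes of HSY's tower. [cite: HuShuYin2019, §4.1 (p. 10 L92)] -/
theorem isCoprime_C_of_forall_prime_mod_three_eq_two {p n : ℕ} (hn : n ≠ 0)
    (hprimes : ∀ q ∈ n.primeFactors, q % 3 = 2) :
    IsCoprime (n : ℤ) (4 * (p : ℤ) ^ 2 + 18 * p + 81) := by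
  rw [Int.isCoprime_iff_gcd_eq_one]
  by_contra hne
  obtain ⟨q, hq, hqdvd⟩ := Nat.exists_prime_and_dvd hne
  have hqn : (q : ℤ) ∣ (n : ℤ) := by
    have h := (Int.natCast_dvd_natCast.mpr hqdvd).trans (Int.gcd_dvd_left (n : ℤ) _)
    exact h
  have hqC : (q : ℤ) ∣ 4 * (p : ℤ) ^ 2 + 18 * p + 81 :=
    (Int.natCast_dvd_natCast.mpr hqdvd).trans (Int.gcd_dvd_right (n : ℤ) _)
  have hqn' : q ∣ n := by exact_mod_cast hqn
  have hq3 : q % 3 = 2 := hprimes q (Nat.mem_primeFactors.mpr ⟨hq, hqn', hn⟩)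
  exact not_dvd_C_of_prime_mod_three_eq_two hq hq3 hqC

/-! ### `Aut(ℂ/K[9pn])` fixes the point `τ/n` of `Y₀(243)` -/

variable {K : Type} [Field K] [NumberField K]

/-- **Every `σ ∈ Aut(ℂ/K[9pn])` fixes Hu–Shu–Yin's CM point of conductor `9pn` on `Y₀(3⁵)`** (transport
form `LevelTransport 243 σ τ τ` for `τ` the root of `(n²A, nB, C)`), for `K` imaginary quadratic with
`d_K = −3` (i.e. `K ≅ ℚ(√−3) = ℚ(ω)`), `ι : K → ℂ`, `p ≡ 1 (mod 3)`, `n ≥ 1`, `3 ∤ n`, `gcd(n, C) = 1`.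
This is the `K[9pn]`-rationality of the point `x(n)` above `P₁ = [τ, 1] ∈ X₀(3⁵)(H_{9p})` (HSY p. 10
L92) in the shape `hfix` consumed by `exists_image_kleinJ_eq_kleinJ_heckeNeighbours_of_fix`,
`exists_ringEquiv_levelTransport_of_isHeckeNeighbour_of_fix` and
`HeegnerTraceOrders.sum_pointGalHom_eq_lFunction_smul_of_fix`; obtained from
`levelTransport_self_of_fix_ringClassField_bezout` with `β = nB`, `c = n²·((p²+4p+16)/3)·C`, `v = 0`.
[cite: HuShuYin2019, §4.1 (p. 10 L92: P₁ = [τ,1] ∈ X₀(3⁵)(H_{9p}))] [cite: Gross1984, §I.1] -/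
theorem levelTransport_self_sylvesterPoint_of_fix (hK : IsImaginaryQuadratic K)
    (hdK : NumberField.discr K = -3) (ι : K →+* ℂ) {p n : ℕ} (hp : p % 3 = 1) (hn : n ≠ 0)
    (hn3 : ¬ 3 ∣ n) (hnC : IsCoprime (n : ℤ) (4 * (p : ℤ) ^ 2 + 18 * p + 81)) {σ : ℂ ≃+* ℂ}
    (hσ : ∀ z ∈ ringClassField K ι (9 * p * n), σ z = z) :
    LevelTransport 243 σ
      (heegnerTau ((n : ℤ) ^ 2 * (81 * ((p : ℤ) ^ 2 + 4 * p + 16)),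
        (n : ℤ) * (-(9 * (4 * (p : ℤ) ^ 2 + 17 * p + 72))), 4 * (p : ℤ) ^ 2 + 18 * p + 81))
      (heegnerTau ((n : ℤ) ^ 2 * (81 * ((p : ℤ) ^ 2 + 4 * p + 16)),
        (n : ℤ) * (-(9 * (4 * (p : ℤ) ^ 2 + 17 * p + 72))), 4 * (p : ℤ) ^ 2 + 18 * p + 81)) := by
  haveI : NeZero (243 : ℕ) := ⟨by norm_num⟩
  have hp0 : p ≠ 0 := by rintro rfl; simp at hp
  have hf : 9 * p * n ≠ 0 := mul_ne_zero (mul_ne_zero (by norm_num) hp0) hn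
  have hQ := sylvesterForm_mem_heegnerForms hp hn hnC
  have hQ' : ((n : ℤ) ^ 2 * (81 * ((p : ℤ) ^ 2 + 4 * p + 16)),
      (n : ℤ) * (-(9 * (4 * (p : ℤ) ^ 2 + 17 * p + 72))), 4 * (p : ℤ) ^ 2 + 18 * p + 81) ∈
      heegnerForms 243 (((9 * p * n : ℕ) : ℤ) ^ 2 * NumberField.discr K) := by
    rw [hdK]; exact hQ
  obtain ⟨k, rfl⟩ := exists_eq_three_mul_add_one hp
  -- Bezout data: `β = nB`, `c = n² (3k²+6k+7) C`, `u·243 + 0·β + w·c = 1`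
  obtain ⟨u, w, huw⟩ := isCoprime_bezoutC (k := k) (n := n) hn3
  refine levelTransport_self_of_fix_ringClassField_bezout hK ι (N := 243) hf hQ'
    (β := (n : ℤ) * (-(9 * (4 * ((3 * k + 1 : ℕ) : ℤ) ^ 2 + 17 * (3 * k + 1 : ℕ) + 72))))
    (c := (n : ℤ) ^ 2 * (3 * (k : ℤ) ^ 2 + 6 * k + 7) *
      (4 * ((3 * k + 1 : ℕ) : ℤ) ^ 2 + 18 * (3 * k + 1 : ℕ) + 81))
    (u := u) (v := 0) (w := w) (Int.ModEq.refl _) ?_ ?_ hσ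
  · rw [hdK]
    push_cast
    ring
  · linear_combination huw

/-- **At `n = 1`: `Aut(ℂ/K[9p])` fixes HSY's `P₁`** (the point `τ_{Q_p}` of `Y₀(3⁵)`), for `d_K = −3`
and `p ≡ 1 (mod 3)` — "`P₁ ∈ X₀(3⁵)(H_{9p})`". [cite: HuShuYin2019, §4.1 (p. 10 L92)] -/
theorem levelTransport_self_sylvesterPoint_one_of_fix (hK : IsImaginaryQuadratic K)
    (hdK : NumberField.discr K = -3) (ι : K →+* ℂ) {p : ℕ} (hp : p % 3 = 1) {σ : ℂ ≃+* ℂ}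
    (hσ : ∀ z ∈ ringClassField K ι (9 * p), σ z = z) :
    LevelTransport 243 σ
      (heegnerTau (81 * ((p : ℤ) ^ 2 + 4 * p + 16), -(9 * (4 * (p : ℤ) ^ 2 + 17 * p + 72)),
        4 * (p : ℤ) ^ 2 + 18 * p + 81))
      (heegnerTau (81 * ((p : ℤ) ^ 2 + 4 * p + 16), -(9 * (4 * (p : ℤ) ^ 2 + 17 * p + 72)),
        4 * (p : ℤ) ^ 2 + 18 * p + 81)) := by
  have h := levelTransport_self_sylvesterPoint_of_fix hK hdK ι (n := 1) hp one_ne_zero (by norm_num)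
    isCoprime_one_left (σ := σ) (by simpa using hσ)
  simpa using h

/-! ### The printed point: `τ_{Q_p} = (2pω − 9)/(9pω − 36)`, `ω = (−1 + √−3)/2` -/

/-- `√(f²D) = f√D` for the normalised square roots `sqrtDisc` (`f ≥ 0`). Private helper. [folklore] -/
private theorem sqrtDisc_sq_mul_neg_three (f : ℕ) :
    sqrtDisc ((f : ℤ) ^ 2 * (-3)) = (f : ℂ) * sqrtDisc (-3) := by
  unfold sqrtDisc
  have hf : (0 : ℝ) ≤ f := Nat.cast_nonneg f
  have h : -(((f : ℤ) ^ 2 * (-3) : ℤ) : ℝ) = (f : ℝ) ^ 2 * (-((-3 : ℤ) : ℝ)) := by push_cast; ring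
  rw [h, Real.sqrt_mul (sq_nonneg _), Real.sqrt_sq hf]
  push_cast
  ring

/-- **HSY's `τ` IS the root of `Q_p`**: as complex numbers,
`τ_{(81(p²+4p+16), −9(4p²+17p+72), 4p²+18p+81)} = (2pω − 9)/(9pω − 36)` with `ω = (−1 + √−3)/2`
(`p ≥ 1`) — Hu–Shu–Yin p. 10 L92 *"Recall `τ = (2pω − 9)/(9pω − 36) ∈ ℋ`"*.  Proof: `√(−243p²) =
2Aτ + B` (`sqrtDisc_eq`) and `√(−243p²) = 9p√−3`, then the identity
`(9p√−3 − B)(9pω − 36) = 2A(2pω − 9)` modulo `(√−3)² = −3`. [cite: HuShuYin2019, §4.1 (p. 10 L92)] -/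
theorem coe_heegnerTau_sylvesterForm {p : ℕ} (hp0 : p ≠ 0) :
    ((heegnerTau (81 * ((p : ℤ) ^ 2 + 4 * p + 16), -(9 * (4 * (p : ℤ) ^ 2 + 17 * p + 72)),
        4 * (p : ℤ) ^ 2 + 18 * p + 81) : ℍ) : ℂ) =
      (2 * p * ((-1 + sqrtDisc (-3)) / 2) - 9) / (9 * p * ((-1 + sqrtDisc (-3)) / 2) - 36) := by
  set s : ℂ := sqrtDisc (-3) with hs_def
  have hs : s ^ 2 = ((-3 : ℤ) : ℂ) := sqrtDisc_sq (by norm_num)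
  push_cast at hs
  -- the denominator is non-zero: otherwise `s = (p + 8)/p` would be real, but `s² = −3`
  have hden : (9 * (p : ℂ) * ((-1 + s) / 2) - 36) ≠ 0 := by
    intro h
    have hs' : s * p = p + 8 := by linear_combination (2 / 9 : ℂ) * h
    have h2 : (s * p) ^ 2 = ((p : ℂ) + 8) ^ 2 := by rw [hs']
    have h3 : ((p + 8) ^ 2 + 3 * p ^ 2 : ℕ) = 0 := by
      have h4 : (((p + 8) ^ 2 + 3 * p ^ 2 : ℕ) : ℂ) = 0 := by
        push_cast
        linear_combination (-1 : ℂ) * h2 + (p : ℂ) ^ 2 * hs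
      exact_mod_cast h4
    have h5 : 0 < (p + 8) ^ 2 + 3 * p ^ 2 := by positivity
    omega
  -- `√(−243p²) = 2Aτ + B` and `√(−243p²) = 9p·s`
  have hA : (0 : ℤ) < 81 * ((p : ℤ) ^ 2 + 4 * p + 16) := by positivity
  have hdisc : (-(9 * (4 * (p : ℤ) ^ 2 + 17 * p + 72))) ^ 2 -
      4 * (81 * ((p : ℤ) ^ 2 + 4 * p + 16)) * (4 * (p : ℤ) ^ 2 + 18 * p + 81) =
      ((9 * p : ℕ) : ℤ) ^ 2 * (-3) := by
    push_cast; ring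
  have hD : ((9 * p : ℕ) : ℤ) ^ 2 * (-3) < 0 := by
    have : (0 : ℤ) < ((9 * p : ℕ) : ℤ) ^ 2 := by positivity
    linarith
  have h := sqrtDisc_eq (Q := (81 * ((p : ℤ) ^ 2 + 4 * p + 16), -(9 * (4 * (p : ℤ) ^ 2 + 17 * p + 72)),
    4 * (p : ℤ) ^ 2 + 18 * p + 81)) hA hdisc hD
  rw [sqrtDisc_sq_mul_neg_three] at h
  simp only at h
  push_cast at h
  rw [eq_div_iff hden]
  have h2A : (2 * (81 * ((p : ℂ) ^ 2 + 4 * p + 16))) ≠ 0 := by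
    have h' : (0 : ℝ) < 2 * (81 * ((p : ℝ) ^ 2 + 4 * p + 16)) := by positivity
    have h'' : (2 * (81 * ((p : ℂ) ^ 2 + 4 * p + 16))) = ((2 * (81 * ((p : ℝ) ^ 2 + 4 * p + 16)) : ℝ) : ℂ) := by
      push_cast; ring
    rw [h'']
    exact_mod_cast h'.ne'
  apply mul_left_cancel₀ h2A
  linear_combination (-(9 * (p : ℂ) * ((-1 + s) / 2) - 36)) * h + ((81 : ℂ) * p ^ 2 / 2) * hs

end Literature.NumberTheory.EllipticCurves.HuShuYin2019

end
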